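import Literature.AlgebraicGeometry.HodgeTheory.RationalHodgeClasses
import Literature.Geometry.Kaehler.NearlyHolomorphicCycleSupport
import Literature.Geometry.Kaehler.AnalyticSetSingularLocusCodim
import Literature.Geometry.Kaehler.AnalyticSetComponentsProofs
import Literature.Geometry.Kaehler.AnalyticSetBranchLocus
import Literature.Geometry.Kaehler.AnalyticSetRegularUnion
import HarnessLib

/-!
# Route HolomorphicityRate — crux `SuperThresholdRigidity` (stmt-HodgeConjecture-2737), stub B2:
# analytic supports are holomorphic supports

Registered stub `stub_holomorphicSupportOfAnalytic` of the skeleton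
`Cruxes/SuperThresholdRigidity/Lines/birth.lean` (line `registered`), signature verbatim. On the
carrier `X^an = A.carrier` of a Hodge model `A` (a boundaryless complex manifold charted on the
finite-dimensional complex space `A.model`), a closed analytic subset `S` all of whose regular
points have complex codimension `≥ p` satisfies, for SOME closed `Sg ⊆ S`, the holomorphic-support
clause of the crux: `S` is analytic near `Sg`, `Sg` lies in a closed analytic `T` all of whose
regular points have codimension `≥ p + 1`, and off `Sg` there are local real `C¹` submersion
charts `f : X^an → ℝ^{2p}` cutting out `S` with `J`-invariant kernel at the base point.

This is the structure theory of analytic sets (Chirka, *Complex Analytic Sets*, §2.3 and §5.2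
Thm. 1–2), entirely proved in the tree; the file only assembles it:

* the bad set is `Sg := S ∖ {x | S is regular of codimension p at x}`, closed because regularity
  of a given codimension is an open condition
  (`Literature.Geometry.Kaehler.isOpen_setOf_isRegularPointOfCodim`);
* `T := sng S ∪ ⋃_{q ≤ dim, q ≠ p} cl (reg_q S)`: the singular locus is analytic (Cartan–Whitney,
  Chirka §5.2 Thm. 2, `Literature.Geometry.Kaehler.isAnalyticSet_singularLocus_holds`) with
  regular points of codimension `≥ p + 1` ("`dim sng A < dim A`",
  `Literature.Geometry.Kaehler.IsAnalyticSet.succ_le_codim_singularLocus`); the closure of a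
  nonempty stratum `reg_q S` is analytic of pure codimension `q` (Chirka §5.2 Thm. 1,
  `Literature.Geometry.Kaehler.IsAnalyticSet.hasPureCodim_closure_regularLocusOfCodim_holds`),
  and `q ≥ p`, `q ≠ p` force `q ≥ p + 1`; lower bounds on the codimension pass to finite unions
  (`Literature.Geometry.Kaehler.forall_regularLocus_union_le`,
  `Literature.Geometry.Kaehler.forall_regularLocus_biUnion_finset_le`); a point of `Sg` is
  either singular or regular of some codimension `q ≠ p`, `q ≤ dim`
  (`Literature.Geometry.Kaehler.IsRegularPointOfCodim.le_finrank`), whence `Sg ⊆ T`;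
* at a good point `x ∈ S ∖ Sg`, i.e. a regular point of codimension `p`, the holomorphic
  equations `f : X^an → ℂᵖ` composed with a real-linear isomorphism `ℂᵖ ≃ ℝ^{2p}` give the real
  `C¹` submersion chart, whose kernel `ker df_x` is `J`-stable because the real differential of
  a holomorphic map is `ℂ`-linear (the argument of
  `Literature.Geometry.Kaehler.IsRegularPointOfCodim.isNearlyHolomorphicRegularPoint`).

The two geometric halves are recorded in the generality of a complex manifold
(`exists_isAnalyticSet_codim_succ_superset_diff_regular` for any boundaryless model with corners,
`exists_realChart_tangentJ_of_isRegularPointOfCodim` for manifolds charted on the model space) and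
then specialised to the Hodge model.

## References

* E. M. Chirka, *Complex Analytic Sets* (1989), §2.3, §5.2 Thm. 1–2. [Chirka1989]
* P. Griffiths, J. Harris, *Principles of Algebraic Geometry* (1978), Ch. 0 §2.
  [GriffithsHarrisPrinciples1978]
* C. Voisin, *Hodge Theory and Complex Algebraic Geometry I* (2002), §2.2.1. [VoisinHodgeI2002]
-/

-- `Summit.HodgeConjecture.HodgeConjecture.Theorems` is the mandated namespace (single-problem summit:
-- Problem = Summit), which `linter.dupNamespace` flags on every declaration; the lakefile turns the
-- linter off tree-wide (weak option), restated here so stand-alone elaboration is warning-free too.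
set_option linter.dupNamespace false

noncomputable section

namespace Summit.HodgeConjecture.HodgeConjecture.Theorems

open scoped Manifold ContDiff Topology
open Set Literature.Geometry.Kaehler

/-! ### The bad set lies in an analytic set of larger codimension -/

section Strata

variable {E : Type*} [NormedAddCommGroup E] [NormedSpace ℂ E] [FiniteDimensional ℂ E]
  {H : Type*} [TopologicalSpace H] {I : ModelWithCorners ℂ E H} [I.Boundaryless]
  {M : Type*} [TopologicalSpace M] [ChartedSpace H M] [IsManifold I 1 M]

/-- The closure of the stratum `reg_q S` of regular points of codimension `q` of an analytic
subset `S` of a complex manifold is an analytic subset: empty if the stratum is empty, and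
otherwise analytic of pure codimension `q` by the decomposition by dimension.
[cite: Chirka1989, §5.2 Thm. 1] -/
theorem isAnalyticSet_closure_regularLocusOfCodim {S : Set M} (hS : IsAnalyticSet I S) (q : ℕ) :
    IsAnalyticSet I (closure (regularLocusOfCodim I S q)) := by
  rcases (regularLocusOfCodim I S q).eq_empty_or_nonempty with h | h
  · rw [h, closure_empty]
    exact isAnalyticSet_empty
  · exact (IsAnalyticSet.hasPureCodim_closure_regularLocusOfCodim_holds I M hS h).1

/-- If every regular point of the analytic set `S` has codimension `≥ p` and `q ≠ p`, then every
regular point of the closure `cl (reg_q S)` of the stratum of codimension `q` has codimension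
`≥ p + 1`: if the stratum is nonempty, `p ≤ q` at one of its points, so `p + 1 ≤ q`, and the
closure has pure codimension `q` (Chirka §5.2 Thm. 1), the codimension at a regular point being
well defined (`IsRegularPointOfCodim.codim_unique`). [cite: Chirka1989, §5.2 Thm. 1 and §2.3] -/
theorem succ_le_codim_closure_regularLocusOfCodim {S : Set M} (hS : IsAnalyticSet I S) {p q : ℕ}
    (hp : ∀ x ∈ regularLocus I S, ∀ r : ℕ, IsRegularPointOfCodim I S r x → p ≤ r) (hqp : q ≠ p) :
    ∀ x ∈ regularLocus I (closure (regularLocusOfCodim I S q)), ∀ r : ℕ,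
      IsRegularPointOfCodim I (closure (regularLocusOfCodim I S q)) r x → p + 1 ≤ r := by
  intro x hx r hr
  rcases (regularLocusOfCodim I S q).eq_empty_or_nonempty with h | h
  · rw [h, closure_empty] at hx
    exact absurd hx.1 (notMem_empty x)
  · have hpure := IsAnalyticSet.hasPureCodim_closure_regularLocusOfCodim_holds I M hS h
    obtain ⟨y, hyS, hyq⟩ := h
    have hpq : p ≤ q := hp y ⟨hyS, q, hyq⟩ q hyq
    have hrq : r = q := IsRegularPointOfCodim.codim_unique hx.1 hr (hpure.2.2 x hx)
    omega

/-- **The bad set of an analytic support lies in an analytic set of larger codimension.** Let `S`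
be an analytic subset of a complex manifold all of whose regular points have codimension `≥ p`.
Then the set of points of `S` at which `S` is NOT regular of codimension `p` is contained in an
analytic subset `T` all of whose regular points have codimension `≥ p + 1`, namely
`T = sng S ∪ ⋃_{q ≤ dim, q ≠ p} cl (reg_q S)`: the singular locus is analytic (Cartan–Whitney,
Chirka §5.2 Thm. 2) of smaller dimension (`IsAnalyticSet.succ_le_codim_singularLocus`), the
closures of the nonempty strata are analytic of pure codimension `q ≥ p + 1` (Chirka §5.2 Thm. 1),
lower bounds on the codimension pass to finite unions (`forall_regularLocus_union_le`), and a
point of `S` not regular of codimension `p` is singular or regular of some codimension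
`q ≠ p`, `q ≤ dim` (`IsRegularPointOfCodim.le_finrank`).
[cite: Chirka1989, §5.2 Thm. 1–2 and §2.3] -/
theorem exists_isAnalyticSet_codim_succ_superset_diff_regular {S : Set M}
    (hS : IsAnalyticSet I S) {p : ℕ}
    (hp : ∀ x ∈ regularLocus I S, ∀ q : ℕ, IsRegularPointOfCodim I S q x → p ≤ q) :
    ∃ T : Set M, S \ {x | IsRegularPointOfCodim I S p x} ⊆ T ∧ (IsAnalyticSet I T ∧
      ∀ x ∈ regularLocus I T, ∀ q : ℕ, IsRegularPointOfCodim I T q x → p + 1 ≤ q) := by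
  classical
  set s : Finset ℕ := (Finset.range (Module.finrank ℂ E + 1)).filter (· ≠ p) with hs
  have hsing : IsAnalyticSet I (singularLocus I S) := isAnalyticSet_singularLocus_holds I M hS
  have hFan : ∀ q ∈ s, IsAnalyticSet I (closure (regularLocusOfCodim I S q)) := fun q _ =>
    isAnalyticSet_closure_regularLocusOfCodim hS q
  refine ⟨singularLocus I S ∪ ⋃ q ∈ s, closure (regularLocusOfCodim I S q), ?_,
    hsing.union (isAnalyticSet_biUnion_finset s hFan), ?_⟩
  · rintro x ⟨hxS, hxp⟩
    by_cases hreg : x ∈ regularLocus I S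
    · obtain ⟨-, q, hq⟩ := hreg
      have hqp : q ≠ p := fun h => hxp (h ▸ hq)
      have hqs : q ∈ s := by
        rw [hs, Finset.mem_filter, Finset.mem_range]
        exact ⟨Nat.lt_succ_of_le hq.le_finrank, hqp⟩
      exact Or.inr (mem_iUnion₂_of_mem hqs (subset_closure ⟨hxS, hq⟩))
    · exact Or.inl ⟨hxS, hreg⟩
  · refine forall_regularLocus_union_le hsing (isAnalyticSet_biUnion_finset s hFan) ?_
      (forall_regularLocus_biUnion_finset_le s hFan fun q hq => ?_)
    · intro x hx q hq
      exact hS.succ_le_codim_singularLocus (fun z c hz hc => hp z ⟨hz, c, hc⟩ c hc) hx.1 hq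
    · exact succ_le_codim_closure_regularLocusOfCodim hS hp (Finset.mem_filter.1 hq).2

end Strata

/-! ### Good points: realified holomorphic submersion charts -/

section GoodPoints

variable {E : Type*} [NormedAddCommGroup E] [NormedSpace ℂ E] [FiniteDimensional ℂ E]
  {M : Type*} [TopologicalSpace M] [ChartedSpace E M] [IsManifold 𝓘(ℂ, E) ω M]
  [IsManifold 𝓘(ℝ, E) ∞ M]

/-- **A regular point of complex codimension `p` is a good point of a holomorphic support.** If
near `x` the set `S` is cut out by `f : M → ℂᵖ` holomorphic on an open `U ∋ x` with `df_x` onto,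
then, composing with a real-linear isomorphism `L : ℂᵖ ≃ ℝ^{2p}`, the map `L ∘ f` is real `C¹`
on `U` (holomorphic maps are real smooth), has the same zero set on `U`, a surjective real
differential `L ∘ df_x` at `x`, and a `J`-invariant kernel: `df_x (J v) = df_x (i v) = i df_x v`
since the real differential of a holomorphic map is `ℂ`-linear. The argument of
`Literature.Geometry.Kaehler.IsRegularPointOfCodim.isNearlyHolomorphicRegularPoint`, with the
`J`-stability stated directly instead of through a metric defect.
[cite: VoisinHodgeI2002, §2.2.1] -/
theorem exists_realChart_tangentJ_of_isRegularPointOfCodim {S : Set M} {p : ℕ} {x : M}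
    (hx : IsRegularPointOfCodim 𝓘(ℂ, E) S p x) :
    ∃ U : Set M, IsOpen U ∧ x ∈ U ∧ ∃ f : M → (Fin (2 * p) → ℝ),
      ContMDiffOn 𝓘(ℝ, E) 𝓘(ℝ, Fin (2 * p) → ℝ) 1 f U ∧ S ∩ U = U ∩ f ⁻¹' {0} ∧
        Function.Surjective (mfderiv 𝓘(ℝ, E) 𝓘(ℝ, Fin (2 * p) → ℝ) f x) ∧
          ∀ v : TangentSpace 𝓘(ℝ, E) x, mfderiv 𝓘(ℝ, E) 𝓘(ℝ, Fin (2 * p) → ℝ) f x v = 0 →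
            mfderiv 𝓘(ℝ, E) 𝓘(ℝ, Fin (2 * p) → ℝ) f x (tangentJ E x v) = 0 := by
  -- adapted from `Literature.Geometry.Kaehler.IsRegularPointOfCodim.isNearlyHolomorphicRegularPoint`
  obtain ⟨U, hU, hxU, f, hf, hSU, hsurj⟩ := hx
  let L : (Fin p → ℂ) ≃L[ℝ] (Fin (2 * p) → ℝ) :=
    ContinuousLinearEquiv.ofFinrankEq (finrank_real_fin_complex p)
  have hfx : MDifferentiableAt 𝓘(ℂ, E) 𝓘(ℂ, Fin p → ℂ) f x :=
    (hf x hxU).mdifferentiableAt (hU.mem_nhds hxU)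
  -- the real differential of `L ∘ f` at `x`
  set D : E →L[ℂ] (Fin p → ℂ) := mfderiv 𝓘(ℂ, E) 𝓘(ℂ, Fin p → ℂ) f x with hD
  have hDf : HasMFDerivAt 𝓘(ℝ, E) 𝓘(ℝ, Fin p → ℂ) f x (D.restrictScalars ℝ) :=
    Literature.NumberTheory.Transcendental.hasMFDerivAt_real_of_complex hfx.hasMFDerivAt
  have hL : HasMFDerivAt 𝓘(ℝ, Fin p → ℂ) 𝓘(ℝ, Fin (2 * p) → ℝ)
      (L : (Fin p → ℂ) → (Fin (2 * p) → ℝ)) (f x) (L : (Fin p → ℂ) →L[ℝ] (Fin (2 * p) → ℝ)) :=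
    (L : (Fin p → ℂ) →L[ℝ] (Fin (2 * p) → ℝ)).hasMFDerivAt
  have hmf : mfderiv 𝓘(ℝ, E) 𝓘(ℝ, Fin (2 * p) → ℝ) ((L : (Fin p → ℂ) → (Fin (2 * p) → ℝ)) ∘ f) x =
      (L : (Fin p → ℂ) →L[ℝ] (Fin (2 * p) → ℝ)).comp (D.restrictScalars ℝ) :=
    (hL.comp x hDf).mfderiv
  have happly : ∀ v : E,
      mfderiv 𝓘(ℝ, E) 𝓘(ℝ, Fin (2 * p) → ℝ) ((L : (Fin p → ℂ) → (Fin (2 * p) → ℝ)) ∘ f) x v =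
        L (D v) := fun v => by
    rw [hmf]
    rfl
  refine ⟨U, hU, hxU, (L : (Fin p → ℂ) → (Fin (2 * p) → ℝ)) ∘ f, ?_, ?_, ?_, ?_⟩
  · -- real `C¹`
    exact (L : (Fin p → ℂ) →L[ℝ] (Fin (2 * p) → ℝ)).contMDiff.comp_contMDiffOn
      ((contMDiffOn_real_of_mdifferentiableOn_complex hf hU).of_le (by exact_mod_cast le_top))
  · -- same zero set
    rw [hSU, Set.preimage_comp]
    congr 1
    ext y
    simp only [mem_preimage, mem_singleton_iff]
    exact (L.map_eq_zero_iff).symm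
  · -- surjective real differential
    intro y
    obtain ⟨v, hv⟩ : ∃ v : E, D v = L.symm y := hsurj (L.symm y)
    exact ⟨v, (happly v).trans (by rw [hv, ContinuousLinearEquiv.apply_symm_apply])⟩
  · -- `J`-stable kernel
    intro v hv
    rw [happly] at hv ⊢
    have hv' : D v = 0 := L.map_eq_zero_iff.1 hv
    rw [tangentJ_apply, D.map_smul, hv', smul_zero, map_zero]
    rfl

end GoodPoints

/-! ### The stub -/

/-- **Stub B2 of crux `SuperThresholdRigidity` — analytic supports are holomorphic supports.** On
the carrier `X^an = A.carrier` of a Hodge model `A` of `X` (a boundaryless complex manifold charted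
on the finite-dimensional `A.model`), a closed analytic subset `S` all of whose regular points have
complex codimension `≥ p` satisfies, for SOME `Sg`, the holomorphic-support clause of the crux:
`S` is closed (`IsAnalyticSet.isClosed`); `Sg := S ∖ {x | S regular of codimension p at x}` is
closed (`isOpen_setOf_isRegularPointOfCodim`) and contained in `S`; `S` is analytic at every point
(in particular on `Sg`); `Sg` lies in the closed analytic set
`T = sng S ∪ ⋃_{q ≤ dim, q ≠ p} cl (reg_q S)` all of whose regular points have codimension
`≥ p + 1` (`exists_isAnalyticSet_codim_succ_superset_diff_regular`: Cartan–Whitney and the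
decomposition by dimension, Chirka §5.2 Thm. 1–2); and every good point `x ∈ S ∖ Sg` is a regular
point of codimension `p`, where the realified holomorphic equations give a real `C¹` submersion
chart `f : X^an → ℝ^{2p}` cutting out `S` with `J`-invariant kernel
(`exists_realChart_tangentJ_of_isRegularPointOfCodim`).
[cite: Chirka1989, §2.3 and §5.2 Thm. 1–2] [cite: GriffithsHarrisPrinciples1978, Ch. 0 §2] -/
theorem stub_holomorphicSupportOfAnalytic : ∀ (n : ℕ) (X : Literature.AlgebraicGeometry.Motives.SchemeOver ℂ) (A : Literature.AlgebraicGeometry.HodgeTheory.HodgeModel n X) (p : ℕ) (S : Set A.carrier), Literature.Geometry.Kaehler.IsAnalyticSet 𝓘(ℂ, A.model) S → (∀ x ∈ Literature.Geometry.Kaehler.regularLocus 𝓘(ℂ, A.model) S, ∀ q : ℕ, Literature.Geometry.Kaehler.IsRegularPointOfCodim 𝓘(ℂ, A.model) S q x → p ≤ q) → ∃ Sg : Set A.carrier, (IsClosed S ∧ IsClosed Sg ∧ Sg ⊆ S ∧ (∀ x ∈ Sg, Literature.Geometry.Kaehler.IsAnalyticSetAt 𝓘(ℂ, A.model) S x)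 ∧ (∃ T : Set A.carrier, Sg ⊆ T ∧ (Literature.Geometry.Kaehler.IsAnalyticSet 𝓘(ℂ, A.model) T ∧ ∀ x ∈ Literature.Geometry.Kaehler.regularLocus 𝓘(ℂ, A.model) T, ∀ q : ℕ, Literature.Geometry.Kaehler.IsRegularPointOfCodim 𝓘(ℂ, A.model) T q x → p + 1 ≤ q)) ∧ (∀ x ∈ S \ Sg, ∃ U : Set A.carrier, IsOpen U ∧ x ∈ U ∧ ∃ f : A.carrier → (Fin (2 * p) → ℝ), ContMDiffOn 𝓘(ℝ, A.model) 𝓘(ℝ, Fin (2 * p) → ℝ) 1 f U ∧ S ∩ U = U ∩ f ⁻¹' {0} ∧ Function.Surjective (mfderiv 𝓘(ℝ, A.model) 𝓘(ℝ, Fin (2 * p) → ℝ) f x) ∧ ∀ v : TangentSpace 𝓘(ℝ, A.model) x, mfderiv 𝓘(ℝ, A.model) 𝓘(ℝ, Fin (2 * p) → ℝ) f x v = 0 → mfderiv 𝓘(ℝ, A.model) 𝓘(ℝ, Fin (2 * p) → ℝ) f x (Literature.Geometry.Kaehler.tangentJ A.model x v) = 0)) := by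
  intro n X A p S hS hp
  obtain ⟨T, hT⟩ :=
    exists_isAnalyticSet_codim_succ_superset_diff_regular (I := 𝓘(ℂ, A.model)) hS hp
  refine ⟨S \ {x | IsRegularPointOfCodim 𝓘(ℂ, A.model) S p x}, hS.isClosed,
    hS.isClosed.sdiff (isOpen_setOf_isRegularPointOfCodim (I := 𝓘(ℂ, A.model)) S p),
    sdiff_subset, fun x _ => hS x, ⟨T, hT⟩, ?_⟩
  rintro x ⟨hxS, hxg⟩
  have hxp : IsRegularPointOfCodim 𝓘(ℂ, A.model) S p x := by
    by_contra h
    exact hxg ⟨hxS, h⟩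
  exact exists_realChart_tangentJ_of_isRegularPointOfCodim hxp

end Summit.HodgeConjecture.HodgeConjecture.Theorems

end
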